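import Summits.Ventures.PercRepro.C025ProfileGirthRowSuccAll
import Summits.Ventures.PercRepro.C025ProfileThinSimplificationRows

/-!
# C-025 AT `(p, q)` ON EVERY MATROID OF GIRTH `≥ p − 1`, FOR EVERY `q` (night-3 g18)

The rows `q ≤ 1` of the profile inequality hold on every finite matroid (g6's `profileHall_zero`, g6/g7's
`profileIneq_one_all`); through the pointwise bridge `rls_of_profileIneq_rows` they give C-025 at `(p, q)` for `q ≤ 1`
and every `p ≥ q + 2` with no hypothesis at all (`rls_of_q_le_one`).  With `rls_of_girth_all` (`q ≥ 2`) this is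
**C-025 at every `(p, q)`, `p ≥ q + 2`, on every matroid in which every set of at most `p − 2` points is independent**
(`rls_of_girth_every`): the girth-`(p − 1)` closure of the C-025 row table (g6 / Theorem G′ territory: girth `≥ p`).
No `def`, no `instance`, no notation.  Axioms: standard.
-/

open scoped Matroid

namespace PercRepro

open Set Finset ThmH Staged

namespace GirthRows

variable {α : Type} [DecidableEq α] {M : Matroid α} [M.Finite]

/-- C-025 at `(p, q)` for `q ≤ 1` and every `p ≥ q + 2`, on every finite matroid (the rows `q = 0` and `q = 1` of the
profile inequality through the pointwise bridge). -/
theorem rls_of_q_le_one (p q : ℕ) (hq : q ≤ 1) (hpq : q + 2 ≤ p) : ThmN.RLS M p q := by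
  apply rls_of_profileIneq_rows
  intro u hqu _
  interval_cases q
  · exact ThinGirth.profileIneq_zero u
  · exact profileIneq_one_all M u (by omega)

/-- **C-025 AT EVERY `(p, q)`, `p ≥ q + 2`, ON EVERY MATROID OF GIRTH `≥ p − 1`**: if every set with at most `p − 2`
points is independent then `ThmN.RLS M p q`. -/
theorem rls_of_girth_every (p q : ℕ) (hpq : q + 2 ≤ p) (hg : ∀ T ⊆ M.E, T.encard + 2 ≤ p → M.Indep T) :
    ThmN.RLS M p q := by
  rcases Nat.lt_or_ge q 2 with hq | hq
  · exact rls_of_q_le_one p q (by omega) hpq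
  · exact rls_of_girth_all p q hq hpq hg

end GirthRows

end PercRepro
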